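import Literature.NumberTheory.Rogawski1990.FinExplicitTransferFactorLocallyConstant   -- ★ p835283: `continuousOn_finExplicitDelta` (finite places)
import Literature.NumberTheory.Rogawski1990.ArchExplicitTransferFactorLocallyConstant  -- F3B: `continuousOn_archExplicitDelta`, `archKappaAt_eventually_eq_of_ne_zero` (archimedean)
import Literature.NumberTheory.Rogawski1990.ExplicitFactorProductFormulaGHRegularArch -- ★ (P-γ) p832705: `archKappaSignAt_rationalArch_eq_one_or_eq_neg_one_of_eval_ne_zero`; ★ `isUnit_eval_finCharpolyTwo_rationalComponent_of_eval_ne_zero`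
import HarnessLib

/-!
# Rogawski's explicit transfer factors are continuous AT every `(G,H)`-regular matching pair WITHIN the matching locus — at every finite place and at `∞` —
# in particular at the localisations of print's rational singular pair `γ_H → γ₀ ∈ M` (Rogawski (1990) Prop. 8.1.3 p. 116, Prop. 8.2.1 (a) p. 118)

Topic `NumberTheory/Rogawski1990`; namespace `Literature.NumberTheory.Rogawski1990`.  THEOREMS ONLY (no definition, no named fact, no instance, no notation,
no `sorry`; net debt 0).  Cell `pub/hodgecm-mathlib`, F0∕P3a, topic T6 (#88 side, node D-G4 of `SIZING-S1prime` §2∕§7): the POINTWISE corollaries of ★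
`continuousOn_finExplicitDelta` (finite `v`) and ★ `continuousOn_archExplicitDelta` (`∞`) in the shape a floor-1 proof of the singular κ-identities ((κ-loc),
(κ-arch) of `S1′`) reads them: continuity of `γ′ ↦ Δ(γ_H¹, γ′)` ALONG THE MATCHING PAIRS converging to a fixed `(G,H)`-regular matching pair, with no side
condition left at the limit point other than `χ_g(u)` a unit (finite `v`) ∕ non-vanishing signs (`∞`) — and both side conditions DISCHARGED at the
localisations of a RATIONAL matching pair `γ_H → γ` with `χ_g(u) ≠ 0` in `L` (print's `γ₀ ∈ M` with `γ_H = (e₁·1₂, e₂)`, `χ_g(e₂) = (e₂ − e₁)² ≠ 0`), by ★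
`isUnit_eval_finCharpolyTwo_rationalComponent_of_eval_ne_zero` ((P-β)) and ★ `archKappaSignAt_rationalArch_eq_one_or_eq_neg_one_of_eval_ne_zero` ((P-γ)).
Mathlib-only footing; count-neutral for the books.

THE MATHEMATICS.  `ContinuousWithinAt f s x` depends only on the germ of `s` at `x` (Mathlib `continuousWithinAt_inter`): the loci of ★
`continuousOn_finExplicitDelta` ∕ ★ `continuousOn_archExplicitDelta` are the matching locus intersected with OPEN conditions (`χ_g(u)` a unit — units are open,
★ `isOpen_setOf_isUnit_localRing` ∕ ★ `isOpen_setOf_isUnit_mixedSpace`; `κ_w ≠ 0` — each `κ_w` is locally constant off its zero set, ★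
`archKappaAt_eventually_eq_of_ne_zero`), so at a point satisfying them the factor is continuous within the bare matching locus.

* §1 (finite `v`) **`continuousWithinAt_finExplicitDelta_of_isUnit`**; rational: **`continuousWithinAt_finExplicitDelta_rationalComponent`**,
  `continuousWithinAt_finExplicitDelta_rationalComponent_toLocal`.
* §2 (`∞`) `continuousWithinAt_archExplicitDelta_of_forall_archKappaAt_ne_zero`, `continuousWithinAt_archCanonicalDelta_of_forall_archKappaAt_ne_zero`
  (pointwise forms of ★ `continuousOn_archExplicitDelta` with the sign hypotheses explicit — the hypothesis-discharging `…_of_isUnit_eval` form at a general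
  local pair is F0P3a-p08's junction file, LEAD T6-48 (b)∕T6-49 boundary); rational:
  `isUnit_eval_archCharpolyTwo_rationalArch_of_eval_ne_zero`, `archKappaAt_rationalArch_ne_zero_of_eval_ne_zero`,
  **`continuousWithinAt_archExplicitDelta_rationalArch`**, **`continuousWithinAt_archCanonicalDelta_rationalArch`**.

HONEST LABEL: HC_CM is proved only modulo the printed citations (named inputs remaining 2) until rung 0 closes; this file proves none of them — it is the
transfer-factor half of the descent datum at print's singular pairs; the orbital-integral half (germs ∕ Harish-Chandra limit formulas) is untouched.

## References
* [Rogawski1990] J. D. Rogawski, *Automorphic Representations of Unitary Groups in Three Variables*, Ann. of Math. Stud. 123 (1990): Prop. 8.1.3 and its proof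
  p. 116 (the transfer factor along `γ_H δ_t → γ_H`), Prop. 8.2.1 (a) p. 118 and the case `E∕F = ℂ∕ℝ` pp. 118–119, §4.9 p. 55, §14.6 p. 242, Lemma 14.5.2 (b)
  proof p. 238.
* [LanglandsShelstad1987] R. P. Langlands, D. Shelstad, *On the definition of transfer factors*, Math. Ann. 278 (1987), Lemma 4.1.A.
-/

set_option autoImplicit false

noncomputable section

open NumberField InfinitePlace IsDedekindDomain Matrix Polynomial Filter Topology
open scoped MatrixGroups

namespace Literature.NumberTheory.Rogawski1990

open Literature.NumberTheory.Automorphic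
open Literature.NumberTheory.GaloisRepresentations
open Literature.AlgebraicGeometry.ShimuraVarieties (hermForm)

/-! ## §1 Finite places -/

section Finite

variable (L : Type) [Field L] [NumberField L] [IsCMField L] (v : HeightOneSpectrum (𝓞 ↥(maximalRealSubfield L)))
  (H' : Matrix (Fin 3) (Fin 3) L)

open scoped Classical in
/-- **`Δ‴_v` IS CONTINUOUS AT A `(G,H)`-REGULAR MATCHING PAIR WITHIN THE MATCHING LOCUS** (every finite `v`, hermitian `H′` with `det H′ ≠ 0`): for
`ι_v(γ_H) ↔ γ′` with `χ_g(u)` a unit, `(γ_H¹, γ′¹) ↦ Δ‴_v(γ_H¹, γ′¹)` restricted to the matching pairs is continuous at `(γ_H, γ′)` — the unit condition is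
open, so it is absorbed into the neighbourhood (★ `continuousOn_finExplicitDelta`, ★ `isOpen_setOf_isUnit_localRing`, Mathlib `continuousWithinAt_inter`).
[cite: Rogawski1990, Prop. 8.1.3 proof p. 116; §4.9 p. 55] [cite: LanglandsShelstad1987, Lemma 4.1.A] -/
theorem continuousWithinAt_finExplicitDelta_of_isUnit (hH : (H'.map (cmConjRingHom L))ᵀ = H') (hdet : H'.det ≠ 0) (μ : HeckeCharacter L)
    {a : (UnitaryGroup.cmDatum L 2 (Matrix.of fun i j : Fin 2 => if i.val + j.val + 1 = 2 then (1 : L) else 0)).Local v ×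
      (UnitaryGroup.cmDatum L 1 (Matrix.of fun i j : Fin 1 => if i.val + j.val + 1 = 1 then (1 : L) else 0)).Local v}
    {b : (UnitaryGroup.cmDatum L 3 H').Local v} (h : IsLocalNormPair L H' v a b)
    (hu : IsUnit ((finCharpolyTwo L v a).eval (finGammaTwo L v a))) :
    ContinuousWithinAt
      (fun q : ((UnitaryGroup.cmDatum L 2 (Matrix.of fun i j : Fin 2 => if i.val + j.val + 1 = 2 then (1 : L) else 0)).Local v ×
        (UnitaryGroup.cmDatum L 1 (Matrix.of fun i j : Fin 1 => if i.val + j.val + 1 = 1 then (1 : L) else 0)).Local v) ×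
        (UnitaryGroup.cmDatum L 3 H').Local v => finExplicitDelta L v H' q.1 μ q.2)
      {q | IsLocalNormPair L H' v q.1 q.2} (a, b) := by
  have hS := continuousOn_finExplicitDelta L v H' hH hdet μ (a, b) ⟨h, hu⟩
  have ht : {q : ((UnitaryGroup.cmDatum L 2 (Matrix.of fun i j : Fin 2 => if i.val + j.val + 1 = 2 then (1 : L) else 0)).Local v ×
        (UnitaryGroup.cmDatum L 1 (Matrix.of fun i j : Fin 1 => if i.val + j.val + 1 = 1 then (1 : L) else 0)).Local v) ×
        (UnitaryGroup.cmDatum L 3 H').Local v | IsUnit ((finCharpolyTwo L v q.1).eval (finGammaTwo L v q.1))} ∈ 𝓝 (a, b) :=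
    ((continuous_eval_finCharpolyTwo L v).comp continuous_fst).continuousAt (x := (a, b)) |>.preimage_mem_nhds
      ((UnitaryGroup.isOpen_setOf_isUnit_localRing L v).mem_nhds hu)
  rw [← continuousWithinAt_inter ht]
  exact hS

variable (γH : (UnitaryGroup.cmDatum L 2 (Matrix.of fun i j : Fin 2 => if i.val + j.val + 1 = 2 then (1 : L) else 0)).Rational ×
    (UnitaryGroup.cmDatum L 1 (Matrix.of fun i j : Fin 1 => if i.val + j.val + 1 = 1 then (1 : L) else 0)).Rational)

open scoped Classical in
/-- **`Δ‴_v` IS CONTINUOUS WITHIN THE MATCHING LOCUS AT `((γ_H)_v, γ′)`** for a RATIONAL `γ_H` with `χ_g(u) ≠ 0` in `L` (possibly `G`-singular — print's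
`γ₀ ∈ M`) and ANY local `γ′` matching `(γ_H)_v` (★ `isUnit_eval_finCharpolyTwo_rationalComponent_of_eval_ne_zero`). [cite: Rogawski1990, Prop. 8.1.3 proof p. 116; Prop. 8.2.1 (a) p. 118] -/
theorem continuousWithinAt_finExplicitDelta_rationalComponent (hH : (H'.map (cmConjRingHom L))ᵀ = H') (hdet : H'.det ≠ 0) (μ : HeckeCharacter L)
    (hχ : ((γH.1.val.val : Matrix (Fin 2) (Fin 2) L).charpoly).eval ((γH.2.val.val : Matrix (Fin 1) (Fin 1) L) 0 0) ≠ 0)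
    {b : (UnitaryGroup.cmDatum L 3 H').Local v} (hb : IsLocalNormPair L H' v (rationalComponent L γH v) b) :
    ContinuousWithinAt
      (fun q : ((UnitaryGroup.cmDatum L 2 (Matrix.of fun i j : Fin 2 => if i.val + j.val + 1 = 2 then (1 : L) else 0)).Local v ×
        (UnitaryGroup.cmDatum L 1 (Matrix.of fun i j : Fin 1 => if i.val + j.val + 1 = 1 then (1 : L) else 0)).Local v) ×
        (UnitaryGroup.cmDatum L 3 H').Local v => finExplicitDelta L v H' q.1 μ q.2)
      {q | IsLocalNormPair L H' v q.1 q.2} (rationalComponent L γH v, b) :=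
  continuousWithinAt_finExplicitDelta_of_isUnit L v H' hH hdet μ hb (isUnit_eval_finCharpolyTwo_rationalComponent_of_eval_ne_zero L γH hχ v)

open scoped Classical in
/-- **The same at the localisation `((γ_H)_v, γ_v)` of a RATIONAL matching pair `γ_H → γ`** (★ `isLocalNormPair_rationalComponent_toLocal_toAdelic`).
[cite: Rogawski1990, Prop. 8.1.3 proof p. 116; Prop. 8.2.1 (a) p. 118] -/
theorem continuousWithinAt_finExplicitDelta_rationalComponent_toLocal (hH : (H'.map (cmConjRingHom L))ᵀ = H') (hdet : H'.det ≠ 0) (μ : HeckeCharacter L)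
    (hχ : ((γH.1.val.val : Matrix (Fin 2) (Fin 2) L).charpoly).eval ((γH.2.val.val : Matrix (Fin 1) (Fin 1) L) 0 0) ≠ 0)
    {γ : (UnitaryGroup.cmDatum L 3 H').Rational} (hγ : IsNormPair L H' γH γ) :
    ContinuousWithinAt
      (fun q : ((UnitaryGroup.cmDatum L 2 (Matrix.of fun i j : Fin 2 => if i.val + j.val + 1 = 2 then (1 : L) else 0)).Local v ×
        (UnitaryGroup.cmDatum L 1 (Matrix.of fun i j : Fin 1 => if i.val + j.val + 1 = 1 then (1 : L) else 0)).Local v) ×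
        (UnitaryGroup.cmDatum L 3 H').Local v => finExplicitDelta L v H' q.1 μ q.2)
      {q | IsLocalNormPair L H' v q.1 q.2}
      (rationalComponent L γH v, (UnitaryGroup.cmDatum L 3 H').toLocal v ((UnitaryGroup.cmDatum L 3 H').toAdelic γ)) :=
  continuousWithinAt_finExplicitDelta_rationalComponent L v H' γH hH hdet μ hχ (isLocalNormPair_rationalComponent_toLocal_toAdelic hγ v)

end Finite

/-! ## §2 The archimedean place -/

section Arch

variable (L : Type) [Field L] [NumberField L] [IsCMField L] (H' : Matrix (Fin 3) (Fin 3) L)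

open scoped Classical in
/-- **Pointwise form of ★ `continuousOn_archExplicitDelta`**: `Δ″_∞` is continuous at a matching pair WITHIN THE MATCHING LOCUS when `χ_g(u)` is a unit and
no sign `κ_w` vanishes AT THAT PAIR (both conditions are open — units of `L ⊗ ℝ` ★ `isOpen_setOf_isUnit_mixedSpace`; ★ `archKappaAt_eventually_eq_of_ne_zero` — so
they are absorbed into the neighbourhood).  The sign hypotheses are the caller's; their discharge from `σ_w(χ_g(u)) ≠ 0` alone at a general local pair
(`…_of_isUnit_eval (hherm) (hanis)`) is F0P3a-p08's junction `ArchExplicitTransferFactorGHRegularContinuous` (LEAD T6-48 (b)), and at a rational pair it is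
(P-γ), below. [cite: Rogawski1990, §14.6 p. 242; Prop. 8.2.1 (a) p. 118] [cite: LanglandsShelstad1987, Lemma 4.1.A] -/
theorem continuousWithinAt_archExplicitDelta_of_forall_archKappaAt_ne_zero (μ : HeckeCharacter L)
    {a : ↥(UnitaryGroup.arch (↥(maximalRealSubfield L)) L (IsCMField.complexConj L) 2
          (Matrix.of fun i j : Fin 2 => if i.val + j.val + 1 = 2 then (1 : L) else 0)) ×
        ↥(UnitaryGroup.arch (↥(maximalRealSubfield L)) L (IsCMField.complexConj L) 1
          (Matrix.of fun i j : Fin 1 => if i.val + j.val + 1 = 1 then (1 : L) else 0))}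
    {b : ↥(UnitaryGroup.arch (↥(maximalRealSubfield L)) L (IsCMField.complexConj L) 3 H')} (h : IsArchNormPair L H' a b)
    (hu : IsUnit ((archCharpolyTwo L a).eval (archGammaTwo L a))) (hκ : ∀ w : {w : InfinitePlace L // IsComplex w}, archKappaAt L H' a w b ≠ 0) :
    ContinuousWithinAt
      (fun q : (↥(UnitaryGroup.arch (↥(maximalRealSubfield L)) L (IsCMField.complexConj L) 2
          (Matrix.of fun i j : Fin 2 => if i.val + j.val + 1 = 2 then (1 : L) else 0)) ×
        ↥(UnitaryGroup.arch (↥(maximalRealSubfield L)) L (IsCMField.complexConj L) 1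
          (Matrix.of fun i j : Fin 1 => if i.val + j.val + 1 = 1 then (1 : L) else 0))) ×
        ↥(UnitaryGroup.arch (↥(maximalRealSubfield L)) L (IsCMField.complexConj L) 3 H') => archExplicitDelta L H' q.1 μ q.2)
      {q | IsArchNormPair L H' q.1 q.2} (a, b) := by
  have hS := continuousOn_archExplicitDelta L H' μ (a, b) ⟨h, hu, hκ⟩
  have ht : {q : (↥(UnitaryGroup.arch (↥(maximalRealSubfield L)) L (IsCMField.complexConj L) 2
          (Matrix.of fun i j : Fin 2 => if i.val + j.val + 1 = 2 then (1 : L) else 0)) ×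
        ↥(UnitaryGroup.arch (↥(maximalRealSubfield L)) L (IsCMField.complexConj L) 1
          (Matrix.of fun i j : Fin 1 => if i.val + j.val + 1 = 1 then (1 : L) else 0))) ×
        ↥(UnitaryGroup.arch (↥(maximalRealSubfield L)) L (IsCMField.complexConj L) 3 H') |
        IsUnit ((archCharpolyTwo L q.1).eval (archGammaTwo L q.1)) ∧
          ∀ w : {w : InfinitePlace L // IsComplex w}, archKappaAt L H' q.1 w q.2 ≠ 0} ∈ 𝓝 (a, b) := by
    have h1 : ∀ᶠ q : (↥(UnitaryGroup.arch (↥(maximalRealSubfield L)) L (IsCMField.complexConj L) 2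
          (Matrix.of fun i j : Fin 2 => if i.val + j.val + 1 = 2 then (1 : L) else 0)) ×
        ↥(UnitaryGroup.arch (↥(maximalRealSubfield L)) L (IsCMField.complexConj L) 1
          (Matrix.of fun i j : Fin 1 => if i.val + j.val + 1 = 1 then (1 : L) else 0))) ×
        ↥(UnitaryGroup.arch (↥(maximalRealSubfield L)) L (IsCMField.complexConj L) 3 H') in 𝓝 (a, b),
        IsUnit ((archCharpolyTwo L q.1).eval (archGammaTwo L q.1)) :=
      ((continuous_eval_archCharpolyTwo L).comp continuous_fst).continuousAt (x := (a, b)) |>.preimage_mem_nhds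
        ((isOpen_setOf_isUnit_mixedSpace L).mem_nhds hu)
    have h2 : ∀ᶠ q : (↥(UnitaryGroup.arch (↥(maximalRealSubfield L)) L (IsCMField.complexConj L) 2
          (Matrix.of fun i j : Fin 2 => if i.val + j.val + 1 = 2 then (1 : L) else 0)) ×
        ↥(UnitaryGroup.arch (↥(maximalRealSubfield L)) L (IsCMField.complexConj L) 1
          (Matrix.of fun i j : Fin 1 => if i.val + j.val + 1 = 1 then (1 : L) else 0))) ×
        ↥(UnitaryGroup.arch (↥(maximalRealSubfield L)) L (IsCMField.complexConj L) 3 H') in 𝓝 (a, b),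
        ∀ w : {w : InfinitePlace L // IsComplex w}, archKappaAt L H' q.1 w q.2 ≠ 0 := by
      refine eventually_all.2 fun w => ?_
      filter_upwards [archKappaAt_eventually_eq_of_ne_zero L H' w (hκ w)] with q hq
      rw [hq]
      exact hκ w
    exact h1.and h2
  rw [← continuousWithinAt_inter ht]
  refine hS.mono fun q hq => ⟨hq.1, hq.2.1, hq.2.2⟩

open scoped Classical in
/-- **The ray `Δ‴_∞ = c(H′)·Δ″_∞` is continuous within the matching locus at the same pairs.** [cite: Rogawski1990, §14.6 p. 242] -/
theorem continuousWithinAt_archCanonicalDelta_of_forall_archKappaAt_ne_zero (μ : HeckeCharacter L)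
    {a : ↥(UnitaryGroup.arch (↥(maximalRealSubfield L)) L (IsCMField.complexConj L) 2
          (Matrix.of fun i j : Fin 2 => if i.val + j.val + 1 = 2 then (1 : L) else 0)) ×
        ↥(UnitaryGroup.arch (↥(maximalRealSubfield L)) L (IsCMField.complexConj L) 1
          (Matrix.of fun i j : Fin 1 => if i.val + j.val + 1 = 1 then (1 : L) else 0))}
    {b : ↥(UnitaryGroup.arch (↥(maximalRealSubfield L)) L (IsCMField.complexConj L) 3 H')} (h : IsArchNormPair L H' a b)
    (hu : IsUnit ((archCharpolyTwo L a).eval (archGammaTwo L a))) (hκ : ∀ w : {w : InfinitePlace L // IsComplex w}, archKappaAt L H' a w b ≠ 0) :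
    ContinuousWithinAt
      (fun q : (↥(UnitaryGroup.arch (↥(maximalRealSubfield L)) L (IsCMField.complexConj L) 2
          (Matrix.of fun i j : Fin 2 => if i.val + j.val + 1 = 2 then (1 : L) else 0)) ×
        ↥(UnitaryGroup.arch (↥(maximalRealSubfield L)) L (IsCMField.complexConj L) 1
          (Matrix.of fun i j : Fin 1 => if i.val + j.val + 1 = 1 then (1 : L) else 0))) ×
        ↥(UnitaryGroup.arch (↥(maximalRealSubfield L)) L (IsCMField.complexConj L) 3 H') => archCanonicalDelta L H' q.1 μ q.2)
      {q | IsArchNormPair L H' q.1 q.2} (a, b) := by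
  simp_rw [archCanonicalDelta_eq_mul]
  exact continuousWithinAt_const.mul (continuousWithinAt_archExplicitDelta_of_forall_archKappaAt_ne_zero L H' μ h hu hκ)

variable (γH : (UnitaryGroup.cmDatum L 2 (Matrix.of fun i j : Fin 2 => if i.val + j.val + 1 = 2 then (1 : L) else 0)).Rational ×
    (UnitaryGroup.cmDatum L 1 (Matrix.of fun i j : Fin 1 => if i.val + j.val + 1 = 1 then (1 : L) else 0)).Rational)

/-- **`χ_g(u) ⊗ 1` is a unit of `L ⊗ ℝ`** for a rational `γ_H` with `χ_g(u) ≠ 0` (★ `archCharpolyTwo_rationalArch`, ★ `archGammaTwo_rationalArch`; a CM field is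
totally complex, so every coordinate of `t ⊗ 1` is `σ_w(t) ≠ 0`). [cite: Rogawski1990, §4.9 p. 55; Prop. 8.2.1 (a) p. 118] -/
theorem isUnit_eval_archCharpolyTwo_rationalArch_of_eval_ne_zero
    (hχ : ((γH.1.val.val : Matrix (Fin 2) (Fin 2) L).charpoly).eval ((γH.2.val.val : Matrix (Fin 1) (Fin 1) L) 0 0) ≠ 0) :
    IsUnit ((archCharpolyTwo L (rationalArch L γH)).eval (archGammaTwo L (rationalArch L γH))) := by
  rw [archCharpolyTwo_rationalArch, archGammaTwo_rationalArch, Polynomial.eval_map, Polynomial.eval₂_hom]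
  rw [Prod.isUnit_iff, Pi.isUnit_iff, Pi.isUnit_iff]
  refine ⟨fun w => absurd w.2 (not_isReal_iff_isComplex.mpr (IsTotallyComplex.isComplex w.1)), fun w => ?_⟩
  rw [isUnit_iff_ne_zero, mixedEmbedding.mixedEmbedding_apply_isComplex]
  exact (_root_.map_ne_zero _).2 hχ

/-- **No sign `κ_w` vanishes at the localisation of a `(G,H)`-regular RATIONAL matching pair** (`c`-hermitian anisotropic `H′`): `κ_w = κ‴_w · η_w` with `κ‴_w = ±1`
(★ (P-γ) `archKappaSignAt_rationalArch_eq_one_or_eq_neg_one_of_eval_ne_zero`) and `η_w ≠ 0` (★ `archMajoritySign_ne_zero`). [cite: Rogawski1990, §14.6 p. 242] -/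
theorem archKappaAt_rationalArch_ne_zero_of_eval_ne_zero (hherm : (H'.map (cmConjRingHom L)).transpose = H')
    (hanis : ∀ x : Fin 3 → L, hermForm (cmConjRingHom L) H' x x = 0 → x = 0)
    (hχ : ((γH.1.val.val : Matrix (Fin 2) (Fin 2) L).charpoly).eval ((γH.2.val.val : Matrix (Fin 1) (Fin 1) L) 0 0) ≠ 0)
    {γ : (UnitaryGroup.cmDatum L 3 H').Rational} (hγ : IsNormPair L H' γH γ) (w : {w : InfinitePlace L // IsComplex w}) :
    archKappaAt L H' (rationalArch L γH) w (cmRationalToArch L 3 H' γ) ≠ 0 := by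
  rw [archKappaAt_eq_archKappaSignAt_mul]
  refine mul_ne_zero ?_ (archMajoritySign_ne_zero L H' w)
  rcases archKappaSignAt_rationalArch_eq_one_or_eq_neg_one_of_eval_ne_zero L H' γH γ hherm hanis hχ hγ w with h1 | h1
  · rw [h1]; exact one_ne_zero
  · rw [h1]; decide

open scoped Classical in
/-- **`Δ″_∞` IS CONTINUOUS WITHIN THE MATCHING LOCUS AT `(γ_H ⊗ 1, γ ⊗ 1)`** for a `(G,H)`-regular RATIONAL matching pair `γ_H → γ` (`χ_g(u) ≠ 0` in `L`; `γ` may be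
`G`-singular — print's `γ₀ ∈ M`), `c`-hermitian anisotropic `H′`, any Hecke character `μ`. [cite: Rogawski1990, Prop. 8.2.1 (a) p. 118, case `E∕F = ℂ∕ℝ` pp. 118–119; Lemma 14.5.2 (b) proof p. 238] -/
theorem continuousWithinAt_archExplicitDelta_rationalArch (hherm : (H'.map (cmConjRingHom L)).transpose = H')
    (hanis : ∀ x : Fin 3 → L, hermForm (cmConjRingHom L) H' x x = 0 → x = 0) (μ : HeckeCharacter L)
    (hχ : ((γH.1.val.val : Matrix (Fin 2) (Fin 2) L).charpoly).eval ((γH.2.val.val : Matrix (Fin 1) (Fin 1) L) 0 0) ≠ 0)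
    {γ : (UnitaryGroup.cmDatum L 3 H').Rational} (hγ : IsNormPair L H' γH γ) :
    ContinuousWithinAt
      (fun q : (↥(UnitaryGroup.arch (↥(maximalRealSubfield L)) L (IsCMField.complexConj L) 2
          (Matrix.of fun i j : Fin 2 => if i.val + j.val + 1 = 2 then (1 : L) else 0)) ×
        ↥(UnitaryGroup.arch (↥(maximalRealSubfield L)) L (IsCMField.complexConj L) 1
          (Matrix.of fun i j : Fin 1 => if i.val + j.val + 1 = 1 then (1 : L) else 0))) ×
        ↥(UnitaryGroup.arch (↥(maximalRealSubfield L)) L (IsCMField.complexConj L) 3 H') => archExplicitDelta L H' q.1 μ q.2)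
      {q | IsArchNormPair L H' q.1 q.2} (rationalArch L γH, cmRationalToArch L 3 H' γ) :=
  continuousWithinAt_archExplicitDelta_of_forall_archKappaAt_ne_zero L H' μ (isArchNormPair_rationalArch_cmRationalToArch hγ)
    (isUnit_eval_archCharpolyTwo_rationalArch_of_eval_ne_zero L γH hχ)
    (archKappaAt_rationalArch_ne_zero_of_eval_ne_zero L H' γH hherm hanis hχ hγ)

open scoped Classical in
/-- **MAIN-b's ray `Δ‴_∞` is continuous within the matching locus at `(γ_H ⊗ 1, γ ⊗ 1)`** under the same hypotheses. [cite: Rogawski1990, §14.6 p. 242; Prop. 8.2.1 (a) p. 118] -/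
theorem continuousWithinAt_archCanonicalDelta_rationalArch (hherm : (H'.map (cmConjRingHom L)).transpose = H')
    (hanis : ∀ x : Fin 3 → L, hermForm (cmConjRingHom L) H' x x = 0 → x = 0) (μ : HeckeCharacter L)
    (hχ : ((γH.1.val.val : Matrix (Fin 2) (Fin 2) L).charpoly).eval ((γH.2.val.val : Matrix (Fin 1) (Fin 1) L) 0 0) ≠ 0)
    {γ : (UnitaryGroup.cmDatum L 3 H').Rational} (hγ : IsNormPair L H' γH γ) :
    ContinuousWithinAt
      (fun q : (↥(UnitaryGroup.arch (↥(maximalRealSubfield L)) L (IsCMField.complexConj L) 2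
          (Matrix.of fun i j : Fin 2 => if i.val + j.val + 1 = 2 then (1 : L) else 0)) ×
        ↥(UnitaryGroup.arch (↥(maximalRealSubfield L)) L (IsCMField.complexConj L) 1
          (Matrix.of fun i j : Fin 1 => if i.val + j.val + 1 = 1 then (1 : L) else 0))) ×
        ↥(UnitaryGroup.arch (↥(maximalRealSubfield L)) L (IsCMField.complexConj L) 3 H') => archCanonicalDelta L H' q.1 μ q.2)
      {q | IsArchNormPair L H' q.1 q.2} (rationalArch L γH, cmRationalToArch L 3 H' γ) :=
  continuousWithinAt_archCanonicalDelta_of_forall_archKappaAt_ne_zero L H' μ (isArchNormPair_rationalArch_cmRationalToArch hγ)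
    (isUnit_eval_archCharpolyTwo_rationalArch_of_eval_ne_zero L γH hχ)
    (archKappaAt_rationalArch_ne_zero_of_eval_ne_zero L H' γH hherm hanis hχ hγ)

end Arch

end Literature.NumberTheory.Rogawski1990

end
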